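import Mathlib
import Summits.MatrixMultiplication.MatrixMultiplication.Theses.SnSubsetDichotomy
import Literature.Combinatorics.Additive.TPPGroupAlgebra
import Summits.MatrixMultiplication.MatrixMultiplication.Theorems.SnSubsetDichotomyJuntaBranchStubRegularity

/-!
# `SnSubsetDichotomy.JuntaBranch` ⇐ its near-maximiser form (line `envelope-stability`, the glue)

Crux `stmt-MatrixMultiplication-8304` (`JuntaBranch`, route `SnSubsetDichotomy`): a near-threshold
("Large", `(n!)^{3/2} e^{-c√n} ≤ |S||T||U|`) triple `S, T, U ⊆ S_n` with the triple product property
and a super-neutral umvirate bump is beaten by the factor `e^{c+1}` in normalised volume by some TPP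
triple at a level `n' ∈ [n - √n, n)` ("Improves").  This file proves, sorry-free and without any
line-local definition, the REDUCTION of the crux to its restriction to saturated near-maximisers
(`juntaBranch_of_nearMaxImproves`, registered sub-goal of the crux): it suffices to prove the
crux's conclusion for triples that are in addition

* partner-saturated (no permutation can be added to `T` or to `U` keeping the property),
* bump-saturated (no permutation of the bump umvirate `U_{I→L} = {σ | σ ∘ I = L}` can be added to
  the bumpy set `S`), and
* `K`-near-maximal at their own level, `K = e^{c+1} n^{3/2}`: every TPP triple of the same `S_n`
  has volume `< K·|S||T||U|`.

Ingredients (all elementary): the property is invariant under the cyclic shift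
`(S,T,U) ↦ (T,U,S)` (tree lemma `TripleProductProperty.rotate`), so the bump may be assumed in the
first set; finite maximality
gives the saturation with the bump preserved (`exists_saturated`, `bump_transfer`); the conclusion
is antitone and the volume floor monotone in the volume; and the one-point REGULARITY of TPP volume
(`stub_regularity`, file `SnSubsetDichotomyJuntaBranchStubRegularity`: `maxVol(n) ≤ n³·maxVol(n-1)`)
turns a same-level competitor with `K` times the volume into an improvement one level down
(`improves_of_sameLevel`), so a triple that is NOT improved is `K`-near-maximal.  The converse
reduction is trivial, so the near-maximiser form is EQUIVALENT to the crux; it is where the crux's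
open content lives (no mechanism is known; `Large` is not known to be satisfiable at any fixed `c`,
BlasiakChurchCohnGrochowUmans2017 §4).
-/

set_option linter.dupNamespace false

open Literature.Combinatorics.Additive
open Summit.MatrixMultiplication.MatrixMultiplication.Theses.SnSubsetDichotomy
open scoped Classical

namespace Summit.MatrixMultiplication.MatrixMultiplication.Theorems.JuntaBranch

/-- **Saturation** (finite maximality): a TPP triple `S, T, U ⊆ S_n` extends to a TPP triple
`S' ⊇ S, T' ⊇ T, U' ⊇ U` whose partners `T', U'` are inclusion-maximal, whose first set is maximal
inside the umvirate `U_{I→L}`, and whose new first-set elements all lie in that umvirate (take a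
triple of maximal total size among the finitely many admissible ones). [folklore] -/
theorem exists_saturated {n t : ℕ} (S T U : Finset (Equiv.Perm (Fin n)))
    (hTPP : TripleProductProperty S T U) (I L : Fin t → Fin n) :
    ∃ S' T' U' : Finset (Equiv.Perm (Fin n)), S ⊆ S' ∧ T ⊆ T' ∧ U ⊆ U' ∧
      TripleProductProperty S' T' U' ∧
      ((∀ g, g ∉ T' → ¬ TripleProductProperty S' (insert g T') U') ∧
        (∀ g, g ∉ U' → ¬ TripleProductProperty S' T' (insert g U'))) ∧
      (∀ g, g ∉ S' → (∀ k, g (I k) = L k) → ¬ TripleProductProperty (insert g S') T' U') ∧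
      (∀ g ∈ S', g ∉ S → ∀ k, g (I k) = L k) := by
  set V : Finset (Equiv.Perm (Fin n)) := S ∪ Finset.univ.filter (fun g => ∀ k, g (I k) = L k)
    with hV
  set F : Finset (Finset (Equiv.Perm (Fin n)) × Finset (Equiv.Perm (Fin n)) ×
      Finset (Equiv.Perm (Fin n))) :=
    Finset.univ.filter (fun x => S ⊆ x.1 ∧ x.1 ⊆ V ∧ T ⊆ x.2.1 ∧ U ⊆ x.2.2 ∧
      TripleProductProperty x.1 x.2.1 x.2.2) with hF
  have hmemF : ∀ x : Finset (Equiv.Perm (Fin n)) × Finset (Equiv.Perm (Fin n)) ×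
      Finset (Equiv.Perm (Fin n)), x ∈ F ↔ (S ⊆ x.1 ∧ x.1 ⊆ V ∧ T ⊆ x.2.1 ∧ U ⊆ x.2.2 ∧
      TripleProductProperty x.1 x.2.1 x.2.2) := by
    intro x
    simp only [hF, Finset.mem_filter, Finset.mem_univ, true_and]
  have h0 : (S, T, U) ∈ F := (hmemF _).2 ⟨subset_rfl, Finset.subset_union_left, subset_rfl,
    subset_rfl, hTPP⟩
  obtain ⟨x, hx, hmax⟩ := F.exists_max_image (fun x => x.1.card + x.2.1.card + x.2.2.card) ⟨_, h0⟩
  obtain ⟨hSx, hxV, hTx, hUx, hTPPx⟩ := (hmemF x).1 hx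
  refine ⟨x.1, x.2.1, x.2.2, hSx, hTx, hUx, hTPPx, ⟨?_, ?_⟩, ?_, ?_⟩
  · intro g hg hTPP'
    have hy : (x.1, insert g x.2.1, x.2.2) ∈ F :=
      (hmemF _).2 ⟨hSx, hxV, hTx.trans (Finset.subset_insert g x.2.1), hUx, hTPP'⟩
    have := hmax _ hy
    simp only [Finset.card_insert_of_notMem hg] at this
    omega
  · intro g hg hTPP'
    have hy : (x.1, x.2.1, insert g x.2.2) ∈ F :=
      (hmemF _).2 ⟨hSx, hxV, hTx, hUx.trans (Finset.subset_insert g x.2.2), hTPP'⟩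
    have := hmax _ hy
    simp only [Finset.card_insert_of_notMem hg] at this
    omega
  · intro g hg hgP hTPP'
    have hgV : g ∈ V := by
      rw [hV, Finset.mem_union, Finset.mem_filter]
      exact Or.inr ⟨Finset.mem_univ g, hgP⟩
    have hy : (insert g x.1, x.2.1, x.2.2) ∈ F :=
      (hmemF _).2 ⟨hSx.trans (Finset.subset_insert g x.1), Finset.insert_subset hgV hxV, hTx, hUx,
        hTPP'⟩
    have := hmax _ hy
    simp only [Finset.card_insert_of_notMem hg] at this
    omega
  · intro g hg hgS
    have hgV : g ∈ V := hxV hg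
    rw [hV, Finset.mem_union, Finset.mem_filter] at hgV
    rcases hgV with h | ⟨-, h⟩
    · exact absurd h hgS
    · exact h

/-- **Bump transfer**: enlarging `S` by elements of the bump umvirate `U_{I→L}` keeps the block
`(I→L)` super-neutral — `n^{(1/2+ε)t}|S| < |S ∩ U_{I→L}|·n^{(t)}` passes from `S` to `S'`.
[folklore] -/
theorem bump_transfer {n : ℕ} {ε : ℝ} {t : ℕ} {I L : Fin t → Fin n}
    {S S' : Finset (Equiv.Perm (Fin n))} (hsub : S ⊆ S')
    (hP : ∀ g ∈ S', g ∉ S → ∀ k, g (I k) = L k)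
    (hb : (n : ℝ) ^ ((1 / 2 + ε) * t) * (S.card : ℝ) <
      ((S.filter (fun σ => ∀ k, σ (I k) = L k)).card : ℝ) * (n.descFactorial t : ℝ)) :
    (n : ℝ) ^ ((1 / 2 + ε) * t) * (S'.card : ℝ) <
      ((S'.filter (fun σ => ∀ k, σ (I k) = L k)).card : ℝ) * (n.descFactorial t : ℝ) := by
  -- cardinal bookkeeping in ℕ
  have h3nat : (S' \ S).card + S.card = S'.card := Finset.card_sdiff_add_card_eq_card hsub
  have hdisj : Disjoint (S.filter (fun σ => ∀ k, σ (I k) = L k)) (S' \ S) :=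
    Finset.disjoint_left.2 (fun g hg hg' => (Finset.mem_sdiff.1 hg').2 (Finset.mem_filter.1 hg).1)
  have hsub4 : S.filter (fun σ => ∀ k, σ (I k) = L k) ∪ (S' \ S) ⊆
      S'.filter (fun σ => ∀ k, σ (I k) = L k) := by
    intro g hg
    rcases Finset.mem_union.1 hg with h | h
    · exact Finset.filter_subset_filter _ hsub h
    · obtain ⟨hgS', hgS⟩ := Finset.mem_sdiff.1 h
      exact Finset.mem_filter.2 ⟨hgS', hP g hgS' hgS⟩
  have h4nat : (S.filter (fun σ => ∀ k, σ (I k) = L k)).card + (S' \ S).card ≤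
      (S'.filter (fun σ => ∀ k, σ (I k) = L k)).card := by
    rw [← Finset.card_union_of_disjoint hdisj]; exact Finset.card_le_card hsub4
  have h2nat : (S.filter (fun σ => ∀ k, σ (I k) = L k)).card ≤ S.card :=
    Finset.card_le_card (Finset.filter_subset _ _)
  -- pass to ℝ
  set a : ℝ := (n : ℝ) ^ ((1 / 2 + ε) * t) with ha
  set D : ℝ := (n.descFactorial t : ℝ) with hD
  set s : ℝ := (S.card : ℝ) with hs
  set s' : ℝ := (S'.card : ℝ) with hs'
  set f : ℝ := ((S.filter (fun σ => ∀ k, σ (I k) = L k)).card : ℝ) with hf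
  set f' : ℝ := ((S'.filter (fun σ => ∀ k, σ (I k) = L k)).card : ℝ) with hf'
  set e : ℝ := ((S' \ S).card : ℝ) with he
  have h3 : s' = s + e := by
    rw [hs', hs, he, ← h3nat]; push_cast; ring
  have h4 : f + e ≤ f' := by rw [hf, he, hf']; exact_mod_cast h4nat
  have h2 : f ≤ s := by rw [hf, hs]; exact_mod_cast h2nat
  have hD0 : 0 ≤ D := Nat.cast_nonneg _
  have he0 : 0 ≤ e := Nat.cast_nonneg _
  have hs0 : 0 ≤ s := Nat.cast_nonneg _
  have haD : a ≤ D := by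
    by_contra hlt
    push Not at hlt
    have h5 : f * D ≤ s * D := mul_le_mul_of_nonneg_right h2 hD0
    have h6 : s * D ≤ s * a := mul_le_mul_of_nonneg_left hlt.le hs0
    linarith
  calc a * s' = a * s + a * e := by rw [h3]; ring
    _ < f * D + D * e := by
        have h7 : a * e ≤ D * e := mul_le_mul_of_nonneg_right haD he0
        linarith
    _ = (f + e) * D := by ring
    _ ≤ f' * D := mul_le_mul_of_nonneg_right h4 hD0

/-- **The conclusion of the crux is antitone in the volume.** [folklore] -/
theorem improves_anti {n : ℕ} {c : ℝ} {V W : ℕ} (h : V ≤ W)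
    (hI : ∃ n' : ℕ, (n : ℝ) - Real.sqrt (n : ℝ) ≤ (n' : ℝ) ∧ n' < n ∧
      ∃ S' T' U' : Finset (Equiv.Perm (Fin n')), TripleProductProperty S' T' U' ∧
        Real.exp (c + 1) * (W : ℝ) * ((n'.factorial : ℝ) / (n.factorial : ℝ)) ^ ((3 : ℝ) / 2) ≤
          ((S'.card * T'.card * U'.card : ℕ) : ℝ)) :
    ∃ n' : ℕ, (n : ℝ) - Real.sqrt (n : ℝ) ≤ (n' : ℝ) ∧ n' < n ∧
      ∃ S' T' U' : Finset (Equiv.Perm (Fin n')), TripleProductProperty S' T' U' ∧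
        Real.exp (c + 1) * (V : ℝ) * ((n'.factorial : ℝ) / (n.factorial : ℝ)) ^ ((3 : ℝ) / 2) ≤
          ((S'.card * T'.card * U'.card : ℕ) : ℝ) := by
  obtain ⟨n', h1, h2, S', T', U', hTPP, hle⟩ := hI
  refine ⟨n', h1, h2, S', T', U', hTPP, le_trans ?_ hle⟩
  have h' : (V : ℝ) ≤ (W : ℝ) := by exact_mod_cast h
  have h0 : (0 : ℝ) ≤ ((n'.factorial : ℝ) / (n.factorial : ℝ)) ^ ((3 : ℝ) / 2) := by positivity
  exact mul_le_mul_of_nonneg_right (mul_le_mul_of_nonneg_left h' (Real.exp_pos _).le) h0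

/-- **Envelope transfer** (one-point regularity, working form): a same-level competitor with
`e^{c+1} n^{3/2}` times the volume is cashed one level down (`n' = n - 1`) by
`stub_regularity` (`maxVol(n) ≤ n³·maxVol(n-1)`). [folklore] -/
theorem improves_of_sameLevel {n : ℕ} (hn : 1 ≤ n) {c : ℝ} {V : ℕ}
    {S₁ T₁ U₁ : Finset (Equiv.Perm (Fin n))} (h₁ : TripleProductProperty S₁ T₁ U₁)
    (hge : Real.exp (c + 1) * (n : ℝ) ^ ((3 : ℝ) / 2) * (V : ℝ) ≤
      ((S₁.card * T₁.card * U₁.card : ℕ) : ℝ)) :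
    ∃ n' : ℕ, (n : ℝ) - Real.sqrt (n : ℝ) ≤ (n' : ℝ) ∧ n' < n ∧
      ∃ S' T' U' : Finset (Equiv.Perm (Fin n')), TripleProductProperty S' T' U' ∧
        Real.exp (c + 1) * (V : ℝ) * ((n'.factorial : ℝ) / (n.factorial : ℝ)) ^ ((3 : ℝ) / 2) ≤
          ((S'.card * T'.card * U'.card : ℕ) : ℝ) := by
  obtain ⟨A, B, C, hABC, hle⟩ := stub_regularity n hn S₁ T₁ U₁ h₁
  refine ⟨n - 1, ?_, Nat.sub_lt hn one_pos, A, B, C, hABC, ?_⟩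
  · rw [Nat.cast_sub hn, Nat.cast_one]
    have : (1 : ℝ) ≤ Real.sqrt n := Real.one_le_sqrt.2 (by exact_mod_cast hn)
    linarith
  · have hnpos : (0 : ℝ) < n := by exact_mod_cast hn
    have hfac : ((n - 1).factorial : ℝ) / (n.factorial : ℝ) = (n : ℝ)⁻¹ := by
      obtain ⟨m, rfl⟩ : ∃ m, n = m + 1 := ⟨n - 1, by omega⟩
      have hm : ((m.factorial : ℕ) : ℝ) ≠ 0 := by exact_mod_cast m.factorial_ne_zero
      simp only [Nat.add_sub_cancel, Nat.factorial_succ, Nat.cast_mul, Nat.cast_add, Nat.cast_one]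
      field_simp
    rw [hfac, Real.inv_rpow hnpos.le]
    set N : ℝ := (n : ℝ) ^ ((3 : ℝ) / 2) with hN
    set W : ℝ := ((A.card * B.card * C.card : ℕ) : ℝ) with hW
    have hNpos : 0 < N := Real.rpow_pos_of_pos hnpos _
    have hcube : (n : ℝ) ^ (3 : ℕ) = N * N := by
      rw [hN, ← Real.rpow_add hnpos, ← Real.rpow_natCast]; norm_num
    rw [hcube] at hle
    have key : Real.exp (c + 1) * (V : ℝ) * N ≤ (N * W) * N := by
      calc Real.exp (c + 1) * (V : ℝ) * N = Real.exp (c + 1) * N * (V : ℝ) := by ring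
        _ ≤ ((S₁.card * T₁.card * U₁.card : ℕ) : ℝ) := hge
        _ ≤ N * N * W := hle
        _ = (N * W) * N := by ring
    have key2 : Real.exp (c + 1) * (V : ℝ) ≤ N * W := le_of_mul_le_mul_right key hNpos
    calc Real.exp (c + 1) * (V : ℝ) * N⁻¹ = (Real.exp (c + 1) * (V : ℝ)) / N := by
          rw [div_eq_mul_inv]
      _ ≤ (N * W) / N := div_le_div_of_nonneg_right key2 hNpos.le
      _ = W := mul_div_cancel_left₀ W hNpos.ne'

/-- **`JuntaBranch` from its near-maximiser form** (registered sub-goal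
`juntaBranch_of_nearMaxImproves` of crux stmt-MatrixMultiplication-8304; the composition of line
`envelope-stability`).  If, for all `ε, c > 0` and `n ≥ n₀(ε,c)`, every TPP triple of `S_n` that is
Large, partner-saturated, `e^{c+1}n^{3/2}`-near-maximal at level `n`, and whose FIRST set has an
`ε`-super-neutral bump at a level `1 ≤ t ≤ √n` inside whose umvirate it is saturated, satisfies the
crux's conclusion, then `JuntaBranch` holds.  Proof: rotate the bump to the front
(`TripleProductProperty.rotate`),
saturate (`exists_saturated`, `bump_transfer`; the volume only grows), and if the saturated triple
were not improved it would be near-maximal (`improves_of_sameLevel`), so the hypothesis improves it;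
antitonicity (`improves_anti`) carries the improvement back to the original triple. -/
theorem juntaBranch_of_nearMaxImproves :
    (∀ ε : ℝ, 0 < ε → ∀ c : ℝ, 0 < c → ∃ n₀ : ℕ, ∀ n ≥ n₀, ∀ S T U : Finset (Equiv.Perm (Fin n)),
      TripleProductProperty S T U →
      (n.factorial : ℝ) ^ ((3 : ℝ) / 2) * Real.exp (-(c * Real.sqrt (n : ℝ))) ≤
        ((S.card * T.card * U.card : ℕ) : ℝ) →
      ((∀ g, g ∉ T → ¬ TripleProductProperty S (insert g T) U) ∧
        (∀ g, g ∉ U → ¬ TripleProductProperty S T (insert g U))) →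
      (∀ S₁ T₁ U₁ : Finset (Equiv.Perm (Fin n)), TripleProductProperty S₁ T₁ U₁ →
        ((S₁.card * T₁.card * U₁.card : ℕ) : ℝ) <
          Real.exp (c + 1) * (n : ℝ) ^ ((3 : ℝ) / 2) * ((S.card * T.card * U.card : ℕ) : ℝ)) →
      ∀ t : ℕ, 1 ≤ t → (t : ℝ) ≤ Real.sqrt (n : ℝ) → ∀ I L : Fin t → Fin n,
        Function.Injective I → Function.Injective L →
        (n : ℝ) ^ ((1 / 2 + ε) * t) * (S.card : ℝ) <
          ((S.filter (fun σ => ∀ k, σ (I k) = L k)).card : ℝ) * (n.descFactorial t : ℝ) →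
        (∀ g, g ∉ S → (∀ k, g (I k) = L k) → ¬ TripleProductProperty (insert g S) T U) →
        ∃ n' : ℕ, (n : ℝ) - Real.sqrt (n : ℝ) ≤ (n' : ℝ) ∧ n' < n ∧
          ∃ S' T' U' : Finset (Equiv.Perm (Fin n')), TripleProductProperty S' T' U' ∧
            Real.exp (c + 1) * ((S.card * T.card * U.card : ℕ) : ℝ) *
                ((n'.factorial : ℝ) / (n.factorial : ℝ)) ^ ((3 : ℝ) / 2) ≤
              ((S'.card * T'.card * U'.card : ℕ) : ℝ)) →
    JuntaBranch := by
  intro hstab ε hε c hc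
  obtain ⟨n₂, h₂⟩ := hstab ε hε c hc
  refine ⟨max 1 n₂, ?_⟩
  intro n hn S T U hTPP hLarge hBumpy
  have hn1 : 1 ≤ n := le_trans (le_max_left _ _) hn
  have hn2 : n₂ ≤ n := le_trans (le_max_right _ _) hn
  -- the core: a Large TPP triple whose FIRST set is bumpy is improved
  have core : ∀ A B C : Finset (Equiv.Perm (Fin n)), TripleProductProperty A B C →
      (n.factorial : ℝ) ^ ((3 : ℝ) / 2) * Real.exp (-(c * Real.sqrt (n : ℝ))) ≤
        ((A.card * B.card * C.card : ℕ) : ℝ) →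
      ∀ t : ℕ, 1 ≤ t → (t : ℝ) ≤ Real.sqrt (n : ℝ) → ∀ I L : Fin t → Fin n,
        Function.Injective I → Function.Injective L →
        (n : ℝ) ^ ((1 / 2 + ε) * t) * (A.card : ℝ) <
          ((A.filter (fun σ => ∀ k, σ (I k) = L k)).card : ℝ) * (n.descFactorial t : ℝ) →
        ∃ n' : ℕ, (n : ℝ) - Real.sqrt (n : ℝ) ≤ (n' : ℝ) ∧ n' < n ∧
          ∃ S' T' U' : Finset (Equiv.Perm (Fin n')), TripleProductProperty S' T' U' ∧
            Real.exp (c + 1) * ((A.card * B.card * C.card : ℕ) : ℝ) *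
                ((n'.factorial : ℝ) / (n.factorial : ℝ)) ^ ((3 : ℝ) / 2) ≤
              ((S'.card * T'.card * U'.card : ℕ) : ℝ) := by
    intro A B C hABC hLA t ht1 ht2 I L hI hL hbump
    by_contra hni
    -- saturate
    obtain ⟨A', B', C', hA, hB, hC, hTPP', hPS, hBS, hP⟩ := exists_saturated A B C hABC I L
    have hvol : A.card * B.card * C.card ≤ A'.card * B'.card * C'.card :=
      Nat.mul_le_mul (Nat.mul_le_mul (Finset.card_le_card hA) (Finset.card_le_card hB))
        (Finset.card_le_card hC)
    have hLA' : (n.factorial : ℝ) ^ ((3 : ℝ) / 2) * Real.exp (-(c * Real.sqrt (n : ℝ))) ≤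
        ((A'.card * B'.card * C'.card : ℕ) : ℝ) := hLA.trans (by exact_mod_cast hvol)
    have hbump' := bump_transfer (ε := ε) hA hP hbump
    -- not improved ⇒ near-maximal at the same level
    have hnear : ∀ S₁ T₁ U₁ : Finset (Equiv.Perm (Fin n)), TripleProductProperty S₁ T₁ U₁ →
        ((S₁.card * T₁.card * U₁.card : ℕ) : ℝ) <
          Real.exp (c + 1) * (n : ℝ) ^ ((3 : ℝ) / 2) * ((A'.card * B'.card * C'.card : ℕ) : ℝ) := by
      intro S₁ T₁ U₁ h₁
      by_contra hge
      push Not at hge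
      exact hni (improves_anti hvol (improves_of_sameLevel hn1 h₁ hge))
    exact hni (improves_anti hvol
      (h₂ n hn2 A' B' C' hTPP' hLA' hPS hnear t ht1 ht2 I L hI hL hbump' hBS))
  -- which set carries the bump: rotate it to the front
  obtain ⟨X, hX, t, ht1, ht2, I, L, hI, hL, hbump⟩ := hBumpy
  rcases hX with hXS | hXT | hXU
  · rw [hXS] at hbump
    exact core S T U hTPP hLarge t ht1 ht2 I L hI hL hbump
  · rw [hXT] at hbump
    have hvolT : T.card * U.card * S.card = S.card * T.card * U.card := by ring
    have hL1 : (n.factorial : ℝ) ^ ((3 : ℝ) / 2) * Real.exp (-(c * Real.sqrt (n : ℝ))) ≤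
        ((T.card * U.card * S.card : ℕ) : ℝ) := by rw [hvolT]; exact hLarge
    have h := core T U S hTPP.rotate hL1 t ht1 ht2 I L hI hL hbump
    rw [hvolT] at h
    exact h
  · rw [hXU] at hbump
    have hvolU : U.card * S.card * T.card = S.card * T.card * U.card := by ring
    have hL1 : (n.factorial : ℝ) ^ ((3 : ℝ) / 2) * Real.exp (-(c * Real.sqrt (n : ℝ))) ≤
        ((U.card * S.card * T.card : ℕ) : ℝ) := by rw [hvolU]; exact hLarge
    have h := core U S T hTPP.rotate.rotate hL1 t ht1 ht2 I L hI hL hbump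
    rw [hvolU] at h
    exact h

end Summit.MatrixMultiplication.MatrixMultiplication.Theorems.JuntaBranch
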